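import Mathlib
import Summits.Ventures.FusionMHD.Models.FluxSurfacePolarRayLevelLoop
import HarnessLib

/-!
# Polar-ray chart, LEVEL direction (VI): the ENCLOSED VOLUME `V(u)` of a star-shaped flux surface in the polar chart, and
# `dV/du = volumeDerivE` — Freidberg's `dV/dψ = 2π∮ dℓ/B_p` (6.22) = Jardin's `V′` (5.29) IS the derivative of the volume

LADDER-GRIDFUSION (F2 item R2 / F1), cell `gridfusion`, seat `gridfusion-model-7` (g5), 2026-08-27.  Companion of
`Models/FluxSurfacePolarRayLevelLoop.lean`.  In the tree `GradShafranov.volumeDerivE ψ γ T := 2π∮ dℓ/B_p` is a DEFINITION carrying the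
printed name «`dV/dψ`» (Freidberg (6.22); Jardin (5.29) `V′ ≡ dV/dψ = 2π∮R dℓ/|∇ψ|`).  This file makes the name a THEOREM for every loop of
level panels: the toroidal volume enclosed by the glued surface `ψ = u`,
`V(u) = ∫∫_{Ω_u} 2πR dR dZ = 2π ∫₀^{2π} ∫₀^{ρ_u(θ)} (R_c + s cos θ)·s ds dθ = 2π ∫₀^{2π} [R_c ρ_u²/2 + ρ_u³ cos θ/3] dθ`
(polar chart `(R, Z) = (R_c + s cos θ, Z_c + s sin θ)`, area element `s ds dθ`, toroidal factor `2πR`; `torVolume`), satisfies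
**`HasDerivAt (torVolume ψ R_c Z_c) (volumeDerivE ψ (loop R_c Z_c ρ_{u₀}) (2π)) u₀`** (`LevelLoop.hasDerivAt_torVolume`) — by the Leibniz
rule across surfaces (`LevelPanel.hasDerivAt_integral` with the kernel `R_c s²/2 + s³cos θ/3`, whose `s`-derivative `(R_c + s cos θ)s`
divided by `D_r` is exactly `volKernel`) and the Loop file's `volumeDerivE_eq`.  Only FIRST ray derivatives enter (no `D₁`).
[folklore] calculus; the functional carries its printed source.  MODELLED: the polar-chart formula for the volume of revolution of a
star-shaped cross-section (elementary geometry; the measure-theoretic identification with `∫∫_{Ω_u} 2πR` is not re-derived here).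
NOT CLAIMED: any value for any equilibrium.
-/

noncomputable section

open Real Set Filter Topology MeasureTheory intervalIntegral
open Literature.MathematicalPhysics.MHD.GradShafranov

namespace Summit.Ventures.FusionMHD.Models

namespace PolarRay

/-! ## §1 The volume kernel -/

/-- The PRIMITIVE volume kernel `R_c s²/2 + s³ cos θ/3 = ∫₀^s (R_c + σ cos θ)·σ dσ` (toroidal volume per radian of `θ` and per `2π`,
swept along the ray up to radius `s`). [cite: Freidberg2014, §6.3.2 eq. (6.22)] -/
def volPrimKernel (Rc : ℝ) (θ s : ℝ) : ℝ := Rc * s ^ 2 / 2 + s ^ 3 * cos θ / 3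

/-- `volPrimKernel R_c θ s = ∫₀^s (R_c + σ cos θ)·σ dσ`. [folklore] -/
theorem volPrimKernel_eq_integral (Rc θ s : ℝ) : volPrimKernel Rc θ s = ∫ σ in (0 : ℝ)..s, (Rc + σ * cos θ) * σ := by
  have e : (fun σ : ℝ => (Rc + σ * cos θ) * σ) = fun σ => Rc * σ ^ 1 + cos θ * σ ^ 2 := by
    funext σ; ring
  rw [e, intervalIntegral.integral_add (by apply Continuous.intervalIntegrable; fun_prop)
    (by apply Continuous.intervalIntegrable; fun_prop), intervalIntegral.integral_const_mul,
    intervalIntegral.integral_const_mul, integral_pow, integral_pow]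
  unfold volPrimKernel
  norm_num
  ring

/-- `∂_s volPrimKernel = (R_c + s cos θ)·s`. [folklore] -/
theorem hasDerivAt_volPrimKernel (Rc θ s : ℝ) : HasDerivAt (volPrimKernel Rc θ) ((Rc + s * cos θ) * s) s := by
  have h1 : HasDerivAt (fun x : ℝ => Rc * x ^ 2 / 2) (Rc * (2 * s) / 2) s := by
    simpa using (((hasDerivAt_pow 2 s).const_mul Rc).div_const 2)
  have h2 : HasDerivAt (fun x : ℝ => x ^ 3 * cos θ / 3) ((3 : ℕ) * s ^ 2 * cos θ / 3) s := by
    simpa using (((hasDerivAt_pow 3 s).mul_const (cos θ)).div_const 3)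
  have h := h1.add h2
  unfold volPrimKernel
  refine h.congr_deriv ?_
  push_cast
  ring

/-- Joint continuity of the volume kernel (a polynomial in `s`, `cos θ`). [folklore] -/
theorem continuousOn_volPrimKernel (Rc : ℝ) (K : Set (ℝ × ℝ)) :
    ContinuousOn (fun p : ℝ × ℝ => volPrimKernel Rc p.1 p.2) K := by
  unfold volPrimKernel; fun_prop

/-- … and of its `s`-derivative. [folklore] -/
theorem continuousOn_volPrimKernelDs (Rc : ℝ) (K : Set (ℝ × ℝ)) :
    ContinuousOn (fun p : ℝ × ℝ => (Rc + p.2 * cos p.1) * p.2) K := by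
  fun_prop

/-- **THE ENCLOSED VOLUME** of the star-shaped region bounded by the glued surface `ψ = u` around `(R_c, Z_c)`:
`V(u) = 2π ∫₀^{2π} [R_c ρ_u(θ)²/2 + ρ_u(θ)³ cos θ/3] dθ = 2π ∫₀^{2π} ∫₀^{ρ_u(θ)} (R_c + s cos θ)·s ds dθ` — the volume of revolution
`∫∫_{Ω_u} 2πR dR dZ` in the polar chart. [cite: Freidberg2014, §6.3.2 eq. (6.22)] -/
def torVolume (ψ : ℝ → ℝ → ℝ) (Rc Zc u : ℝ) : ℝ :=
  2 * π * ∫ θ in (0 : ℝ)..(2 * π), volPrimKernel Rc θ (rayRadius ψ Rc Zc u θ)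

/-! ## §2 The panel piece and the loop: `dV/du = volumeDerivE` -/

namespace LevelPanel

variable {ψ : ℝ → ℝ → ℝ} {Rc Zc a b s₁ s₂ uin uout : ℝ} {D : ℝ → ℝ → ℝ}

/-- **PANEL PIECE OF `dV/du`**: `d/du|_{u₀} ∫ₐᵇ volPrimKernel(θ, ρ_u θ) dθ = ∫ₐᵇ volKernel R_c D θ (ρ_{u₀} θ) dθ` (first derivatives only).
[cite: Jardin2010, §5.3 eq. (5.29)] -/
theorem hasDerivAt_volPrimIntegral (P : LevelPanel ψ Rc Zc a b s₁ s₂ uin uout D) {u₀ : ℝ} (hu₀ : u₀ ∈ Ioo uin uout) :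
    IntervalIntegrable (fun θ => volKernel Rc D θ (rayRadius ψ Rc Zc u₀ θ)) volume a b ∧
    HasDerivAt (fun u => ∫ θ in a..b, volPrimKernel Rc θ (rayRadius ψ Rc Zc u θ))
      (∫ θ in a..b, volKernel Rc D θ (rayRadius ψ Rc Zc u₀ θ)) u₀ :=
  P.hasDerivAt_integral hu₀ (k := volPrimKernel Rc) (k₁ := fun θ s => (Rc + s * cos θ) * s)
    (fun θ _ s _ => hasDerivAt_volPrimKernel Rc θ s) (continuousOn_volPrimKernel Rc _) (continuousOn_volPrimKernelDs Rc _)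

end LevelPanel

namespace LevelLoop

variable {ψ : ℝ → ℝ → ℝ} {Rc Zc uin uout : ℝ} {D : ℝ → ℝ → ℝ} {N : ℕ} {t σ₁ σ₂ : ℕ → ℝ}
  {L : ℝ → ℝ → (ℝ × ℝ →L[ℝ] ℝ)}

/-- **`dV/du` of the enclosed volume as a polar integral**: `HasDerivAt (torVolume ψ R_c Z_c) (2π∫₀^{2π} volKernel(θ, ρ_{u₀} θ) dθ) u₀`
for every admissible `u₀` of a loop of level panels. [cite: Jardin2010, §5.3 eq. (5.29)] -/
theorem hasDerivAt_torVolume_polar (Λ : LevelLoop ψ Rc Zc uin uout D N t σ₁ σ₂) {u₀ : ℝ} (hu₀ : u₀ ∈ Ioo uin uout) :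
    HasDerivAt (torVolume ψ Rc Zc) (2 * π * ∫ θ in (0 : ℝ)..(2 * π), volKernel Rc D θ (rayRadius ψ Rc Zc u₀ θ)) u₀ := by
  have h := hasDerivAt_integral_of_adjacent (N := N) (t := t)
    (F := fun u θ => volPrimKernel Rc θ (rayRadius ψ Rc Zc u θ))
    (G := fun θ => volKernel Rc D θ (rayRadius ψ Rc Zc u₀ θ)) (u₀ := u₀)
    (fun j hj => (Λ.panel j hj).eventually_intervalIntegrable_kernel (continuousOn_volPrimKernel Rc _) hu₀)
    (fun j hj => ((Λ.panel j hj).hasDerivAt_volPrimIntegral hu₀).1)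
    (fun j hj => ((Λ.panel j hj).hasDerivAt_volPrimIntegral hu₀).2)
  rw [Λ.t_zero, Λ.t_last] at h
  exact h.const_mul (2 * π)

/-- **FREIDBERG'S `dV/dψ` IS THE DERIVATIVE OF THE VOLUME**: with the Fréchet derivative of `ψ` at the ray points and `R > 0` on the
boxes (the Loop file's identification hypotheses), `HasDerivAt (torVolume ψ R_c Z_c) (volumeDerivE ψ (loop R_c Z_c ρ_{u₀}) (2π)) u₀`.
[cite: Freidberg2014, §6.3.2 eq. (6.22)] -/
theorem hasDerivAt_torVolume (Λ : LevelLoop ψ Rc Zc uin uout D N t σ₁ σ₂)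
    (hψ : ∀ j < N, ∀ θ ∈ Icc (t j) (t (j + 1)), ∀ s ∈ Icc (σ₁ j) (σ₂ j),
      HasFDerivAt (fun p : ℝ × ℝ => ψ p.1 p.2) (L θ s) (rayPoint Rc Zc θ s))
    (hR : ∀ j < N, ∀ θ ∈ Icc (t j) (t (j + 1)), ∀ s ∈ Icc (σ₁ j) (σ₂ j), 0 < Rc + s * cos θ)
    {u₀ : ℝ} (hu₀ : u₀ ∈ Ioo uin uout) :
    HasDerivAt (torVolume ψ Rc Zc) (volumeDerivE ψ (loop Rc Zc (rayRadius ψ Rc Zc u₀)) (2 * π)) u₀ := by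
  rw [Λ.volumeDerivE_eq hψ hR hu₀]
  exact Λ.hasDerivAt_torVolume_polar hu₀

/-- … in `deriv` form: `(torVolume ψ R_c Z_c)′(u₀) = volumeDerivE ψ (loop R_c Z_c ρ_{u₀}) (2π)` — so `volumeDerivE` IS `dV/du` and the
enclosed volume is a legitimate surface label wherever it is positive («an arbitrary magnetic surface label», (8.134)).
[cite: Freidberg2014, §6.3.2 eq. (6.22)] -/
theorem deriv_torVolume (Λ : LevelLoop ψ Rc Zc uin uout D N t σ₁ σ₂)
    (hψ : ∀ j < N, ∀ θ ∈ Icc (t j) (t (j + 1)), ∀ s ∈ Icc (σ₁ j) (σ₂ j),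
      HasFDerivAt (fun p : ℝ × ℝ => ψ p.1 p.2) (L θ s) (rayPoint Rc Zc θ s))
    (hR : ∀ j < N, ∀ θ ∈ Icc (t j) (t (j + 1)), ∀ s ∈ Icc (σ₁ j) (σ₂ j), 0 < Rc + s * cos θ)
    {u₀ : ℝ} (hu₀ : u₀ ∈ Ioo uin uout) :
    deriv (torVolume ψ Rc Zc) u₀ = volumeDerivE ψ (loop Rc Zc (rayRadius ψ Rc Zc u₀)) (2 * π) :=
  (Λ.hasDerivAt_torVolume hψ hR hu₀).deriv

end LevelLoop

end PolarRay

end Summit.Ventures.FusionMHD.Models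

end
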